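import Summits.PneNP.PneNP.Theorems.PairwiseSASDPPairs
import Summits.PneNP.PneNP.Theorems.PstarSASDPPairs

/-!
# T23.3 — the biased-BGMT hub with the degree-2 SDP layer: `SASDPFeasible` from pairwise-independent fibre laws (cell `pnp-ideate`)

FRONTIER range-avoidance ladder, rung F-N3 context (restricted-model lower bound for the mixed Sherali–Adams + SDP hierarchy,
`PstarSASDPLevel.SASDPFeasible`; cell `pnp-ideate`, ROUND-23 item T23.3) — nothing here bears on `P` vs `NP`.

`pairwiseSASDPLinearLevel`: for every arity `k ≥ 3` and ratio `a/b` with `(3k−7)·b < 3a` (i.e. `a/b > k − 3 + 2/3`, BGMT's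
`ε > 2/3`) there is `c > 0` such that every `k`-local map with injective slots and SIMPLE OVERLAPS that is `(r, a/b)`-boundary
expanding and carries pairwise-independent fibre laws with variable-consistent biases (`PairwiseLaws I y p μ`) has the fibre of `y`
feasible for level-`r/c` Sherali–Adams TOGETHER WITH the PSD level-2 moment matrix (`SASDPFeasible (r/c) I y`).  The laws are those
of the hub `PairwiseSA.pairwiseSALinearLevel` (closure laws `S ↦ law I p μ (cl S)`; the bias-product law `W I p μ ∅` at level `0`
or in the degenerate ratio `b = 0`); the new point is the biased BGMT Claim 3.4 at general arity: `{v}`, `{v,w}` dominate nothing and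
`G − {v,w}` stays expanding under the strengthened gate + simple overlaps (`expandingOff_of_card_le_two`), so `law_consistent` pulls
the singleton / pair marginals back to `p v`, `p v · p w` and `PstarSA2Blind.posSemidef_momentMatrix_product` applies.  At `k = 4`,
`a/b = 7/4` this is `PstarTypedSASDPLinearLevel.typedSASDPLinearLevel`; COR-A / HEADLINE-22/23 inherit "+ SDP₂" through it.
-/

set_option linter.dupNamespace false

open Finset Literature.Computability.Complexity
open Summit.PneNP.PneNP.Theorems.PstarPairwise (rho)
open Summit.PneNP.PneNP.Theorems.PstarSA2Blind (momentMatrix posSemidef_momentMatrix_product)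
open Summit.PneNP.PneNP.Theorems.PstarSALevel (cyl varSet bdry SimpleOverlap)
open Summit.PneNP.PneNP.Theorems.PstarSASDPLevel (BoundaryExpandingQ single pair SASDPFeasible)
open Summit.PneNP.PneNP.Theorems.PairwiseSALevel (PairwiseLaws card_varSet_of_injective)
open Summit.PneNP.PneNP.Theorems.PstarSAClosureQ (exists_closureQ)
open Summit.PneNP.PneNP.Theorems.PstarSAPeeling (saProps_of_closure)

namespace Summit.PneNP.PneNP.Theorems.PairwiseSA

variable {k n m : ℕ}

/-- **T23.3 — BIASED BGMT WITH THE SDP LAYER.**  For every arity `k ≥ 3` and ratio `a/b` with `(3k−7)·b < 3a` there is `c > 0` such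
that every `k`-local map with injective slots and simple overlaps that is `(r, a/b)`-boundary expanding, together with pairwise-independent
fibre laws with variable-consistent biases for `I(x) = y`, makes the fibre of `y` feasible for level-`r/c` Sherali–Adams plus the PSD
level-2 moment matrix.  Restricted-model lower bound for a relaxation hierarchy (cell pnp-ideate, ROUND-23); it says nothing about `P`
versus `NP`. -/
theorem pairwiseSASDPLinearLevel : ∀ k a b : ℕ, 3 ≤ k → (3 * k - 7) * b < 3 * a → ∃ c : ℕ, 0 < c ∧
    ∀ (n m r : ℕ) (I : LocalMap k n m) (y : Fin m → Bool) (p : Fin n → ℝ) (μ : Fin m → (Fin k → Bool) → ℝ),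
      (∀ j, Function.Injective (I.vars j)) → PairwiseLaws I y p μ → BoundaryExpandingQ a b r I → SimpleOverlap I →
      SASDPFeasible (r / c) I y := by
  intro k a b hk hab37
  obtain ⟨d, rfl⟩ := Nat.exists_eq_add_of_le hk
  have hd : 3 + d - 3 = d := by omega
  have hab : d * b < a := by
    have h37 : 3 * (3 + d) - 7 = 3 * d + 2 := by omega
    rw [h37] at hab37
    have : 3 * (d * b) < 3 * a := by nlinarith
    omega
  -- constants
  obtain ⟨K₁, hK₁⟩ : ∃ K₁ : ℕ, K₁ = 1 + 2 * (3 + d) * b * b := ⟨_, rfl⟩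
  obtain ⟨c, hc⟩ : ∃ c : ℕ, c = 2 * b * K₁ + 2 * b * b + 1 := ⟨_, rfl⟩
  refine ⟨c, by omega, fun n m r I y p μ hinj hL hB hSO => ?_⟩
  classical
  have hk3 : 3 ≤ 3 + d := by omega
  obtain ⟨t, ht⟩ : ∃ t : ℕ, t = r / c := ⟨_, rfl⟩
  rw [← ht]
  have hct : c * t ≤ r := by rw [ht]; exact Nat.mul_div_le r c
  have ha : 0 < a := by omega
  have hp01 : ∀ v, 0 ≤ p v ∧ p v ≤ 1 := fun v => ⟨(hL.bias_pos v).le, (hL.bias_lt_one v).le⟩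
  -- the bias-product law is an SA+SDP witness whenever no output lives inside `≤ t` variables
  have hprod : (∀ (S : Finset (Fin n)) (j : Fin m), S.card ≤ t → ¬ varSet I j ⊆ S) → SASDPFeasible t I y := by
    intro hvac
    refine ⟨fun _ => W I p μ ∅, fun S _ => ⟨fun x => W_nonneg hL ∅ x, sum_W_empty I p μ⟩, fun S T _ _ a' => rfl,
      fun S j hS hj x _ => absurd hj (hvac S j hS), ?_⟩
    have hs : single (fun _ : Finset (Fin n) => W I p μ ∅) = p := funext fun v => single_W_empty I p μ v
    have hpq : ∀ u v : Fin n, u ≠ v → pair (fun _ : Finset (Fin n) => W I p μ ∅) u v = p u * p v :=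
      fun u v huv => pair_W_empty I p μ huv
    rw [hs, PstarSAPeeling.momentMatrix_congr_offDiag p hpq]
    exact posSemidef_momentMatrix_product p hp01
  have hkS : ∀ (S : Finset (Fin n)) (j : Fin m), S.card < 3 + d → ¬ varSet I j ⊆ S := fun S j hS hsub' => by
    have := card_le_card hsub'
    rw [card_varSet_of_injective I (hinj j)] at this
    omega
  rcases Nat.eq_zero_or_pos b with hb0 | hb
  · -- degenerate ratio `b = 0`: no output survives a budget `r ≥ 1`, and `r = 0` leaves only `S = ∅`
    subst hb0
    refine hprod fun S j hS hj => ?_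
    rcases Nat.eq_zero_or_pos r with hr0 | hr
    · have ht0 : t = 0 := by rw [ht, hr0, Nat.zero_div]
      exact hkS S j (by omega) hj
    · have h1 := hB {j} (by rw [card_singleton]; exact hr)
      rw [card_singleton, zero_mul] at h1
      omega
  · -- the intermediate ratio `a₂/b₂ = (a + d·b)/(2b)` and the gap `g`
    obtain ⟨a₂, ha₂⟩ : ∃ a₂ : ℕ, a₂ = a + d * b := ⟨_, rfl⟩
    obtain ⟨b₂, hb₂⟩ : ∃ b₂ : ℕ, b₂ = 2 * b := ⟨_, rfl⟩
    have hdbb : d * b * b < a * b := Nat.mul_lt_mul_of_pos_right hab hb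
    have hab₂ : a₂ * b < a * b₂ := by
      rw [ha₂, hb₂]
      nlinarith [hdbb]
    obtain ⟨g, hg⟩ : ∃ g : ℕ, g = a * b₂ - a₂ * b := ⟨_, rfl⟩
    have hg1 : 1 ≤ g := by rw [hg]; omega
    have hb₂pos : 0 < b₂ := by rw [hb₂]; omega
    -- the closure (BGMT Thm 3.1 at ratio `a₂/b₂`, prover-1's `exists_closureQ`)
    choose cl hsub hclcard hclosed using fun S : Finset (Fin n) => exists_closureQ I a b a₂ b₂ r hab₂ hB S
    simp only [← hg] at hclcard hclosed
    -- closures are small: `#cl S ≤ K₁ · #S`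
    have hK : ∀ S : Finset (Fin n), (cl S).card ≤ K₁ * S.card := by
      intro S
      have h1 := hclcard S
      have hX : 1 * (2 * (3 + d) * b * b * S.card) ≤ g * (2 * (3 + d) * b * b * S.card) := Nat.mul_le_mul_right _ hg1
      have h2 : (g + (3 + d) * (b * b₂)) * S.card ≤ g * (K₁ * S.card) :=
        calc (g + (3 + d) * (b * b₂)) * S.card = g * S.card + 1 * (2 * (3 + d) * b * b * S.card) := by rw [hb₂]; ring
          _ ≤ g * S.card + g * (2 * (3 + d) * b * b * S.card) := by omega
          _ = g * (K₁ * S.card) := by rw [hK₁]; ring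
      exact Nat.le_of_mul_le_mul_left (h1.trans h2) (by omega)
    -- the closedness predicate at budget `t`
    let Closed : Finset (Fin n) → Prop := fun S₁ => ∀ M : Finset (Fin m), M.Nonempty →
      (∀ j ∈ M, ¬ varSet I j ⊆ S₁) → g * M.card + b * b₂ * t ≤ g * r → a₂ * M.card ≤ b₂ * (bdry I M \ S₁).card
    have hClosed : ∀ S : Finset (Fin n), S.card ≤ t → Closed (cl S) := by
      intro S hS M hM hnd hbud
      refine hclosed S M hM hnd (le_trans ?_ hbud)
      have := Nat.mul_le_mul_left (b * b₂) hS
      omega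
    -- closedness gives expansion off `S₁` for budgeted non-dominated families
    have hstrict : ∀ {S₁ : Finset (Fin n)} {J : Finset (Fin m)}, Closed S₁ → J.Nonempty →
        (∀ j ∈ J, ¬ varSet I j ⊆ S₁) → g * J.card + b * b₂ * t ≤ g * r → (3 + d - 3) * J.card < (bdry I J \ S₁).card := by
      intro S₁ J hC hne hnd hbud
      rw [hd]
      have h5 := hC J hne hnd hbud
      have hpos := hne.card_pos
      have hlt : 2 * (d * b) < a₂ := by rw [ha₂]; omega
      have h6 : b₂ * (d * J.card) < b₂ * (bdry I J \ S₁).card :=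
        calc b₂ * (d * J.card) = (2 * (d * b)) * J.card := by rw [hb₂]; ring
          _ < a₂ * J.card := Nat.mul_lt_mul_of_pos_right hlt hpos
          _ ≤ b₂ * (bdry I J \ S₁).card := h5
      exact Nat.lt_of_mul_lt_mul_left h6
    -- dominated families of sets within budget `2K₁t` are small (when `t ≥ 1`)
    have hdomB : ∀ {S' : Finset (Fin n)}, S'.card ≤ 2 * K₁ * t → 0 < t →
        (dom I S').card ≤ r ∧ a * (dom I S').card ≤ b * S'.card := by
      intro S' hS' htpos
      refine card_dom_le hB ?_
      have h1 : b * S'.card ≤ 2 * b * K₁ * t :=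
        calc b * S'.card ≤ b * (2 * K₁ * t) := Nat.mul_le_mul_left b hS'
          _ = 2 * b * K₁ * t := by ring
      have h2 : 2 * b * K₁ * t < c * t :=
        Nat.mul_lt_mul_of_pos_right (by rw [hc]; exact Nat.lt_succ_of_le (Nat.le_add_right _ _)) htpos
      have h3 : c * t ≤ a * r := hct.trans (Nat.le_mul_of_pos_left r ha)
      omega
    -- the Sherali–Adams family `S ↦ law (cl S)`
    obtain ⟨h1, h2, -⟩ := saProps_of_closure I y t (2 * K₁ * t) Closed cl (law I p μ) hsub hClosed
      (fun S hS => by have := hK S; have := Nat.mul_le_mul_left K₁ hS; nlinarith)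
      (fun S x => law_nonneg hL S x)
      (fun S' hS' => by
        rcases Nat.eq_zero_or_pos t with ht0 | htpos
        · have hS0 : S' = ∅ := card_eq_zero.1 (by rw [ht0, mul_zero] at hS'; omega)
          subst hS0
          refine law_total hL hinj hk3 ?_
          rw [dom_empty I (by omega)]
          exact expandingOff_empty I ∅
        · exact law_total_of_boundaryExpandingQ hL hinj hk3 (by rw [hd]; exact hab) hB (hdomB hS' htpos).1)
      (fun S j x hj hx => law_support hL hj hx)
      (fun S₁ S₂ hC h12 hS₂ a' => by
        refine law_consistent hL hinj hk3 h12 ?_ a'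
        intro J hJ hne
        rcases Nat.eq_zero_or_pos t with ht0 | htpos
        · exfalso
          have hS0 : S₂ = ∅ := card_eq_zero.1 (by rw [ht0, mul_zero] at hS₂; omega)
          subst hS0
          rw [dom_empty I (by omega), empty_sdiff] at hJ
          exact absurd hne (by rw [subset_empty.1 hJ]; exact not_nonempty_empty)
        · obtain ⟨-, hdom3⟩ := hdomB hS₂ htpos
          have hJc : J.card ≤ (dom I S₂).card := card_le_card (hJ.trans sdiff_subset)
          have hnd : ∀ j ∈ J, ¬ varSet I j ⊆ S₁ := fun j hj h => (mem_sdiff.1 (hJ hj)).2 (mem_dom.2 h)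
          refine hstrict hC hne hnd ?_
          -- the budget: `a·(g·#J + b b₂ t) ≤ a·g·r`
          have e1 : a * (g * J.card) ≤ g * (2 * b * K₁ * t) :=
            calc a * (g * J.card) = g * (a * J.card) := by ring
              _ ≤ g * (a * (dom I S₂).card) := Nat.mul_le_mul_left g (Nat.mul_le_mul_left a hJc)
              _ ≤ g * (b * S₂.card) := Nat.mul_le_mul_left g hdom3
              _ ≤ g * (b * (2 * K₁ * t)) := Nat.mul_le_mul_left g (Nat.mul_le_mul_left b hS₂)
              _ = g * (2 * b * K₁ * t) := by ring
          have e2 : g * (2 * b * K₁) ≤ a * (g * (2 * b * K₁)) := Nat.le_mul_of_pos_left _ ha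
          have e3 : 2 * a * b * b ≤ g * (2 * a * b * b) := Nat.le_mul_of_pos_left _ hg1
          have e4 : a * (g * J.card + b * b₂ * t) ≤ a * (g * r) :=
            calc a * (g * J.card + b * b₂ * t) = a * (g * J.card) + 2 * a * b * b * t := by rw [hb₂]; ring
              _ ≤ g * (2 * b * K₁ * t) + 2 * a * b * b * t := by omega
              _ = (g * (2 * b * K₁) + 2 * a * b * b) * t := by ring
              _ ≤ (a * (g * (2 * b * K₁)) + g * (2 * a * b * b)) * t := Nat.mul_le_mul_right t (add_le_add e2 e3)
              _ = a * g * (2 * b * K₁ + 2 * b * b) * t := by ring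
              _ ≤ a * g * c * t := by
                  refine Nat.mul_le_mul_right t (Nat.mul_le_mul_left (a * g) ?_)
                  rw [hc]; omega
              _ = a * (g * (c * t)) := by ring
              _ ≤ a * (g * r) := Nat.mul_le_mul_left a (Nat.mul_le_mul_left g hct)
          exact Nat.le_of_mul_le_mul_left e4 ha)
    -- small level: the bias-product law
    rcases Nat.eq_zero_or_pos t with ht0 | htpos
    · exact hprod fun S j hS => hkS S j (by omega)
    refine ⟨fun S => law I p μ (cl S), h1, h2, fun S j hS hj x hx => law_support hL (hj.trans (hsub S)) hx, ?_⟩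
    -- biased BGMT Claim 3.4: singleton / pair marginals of the closure laws are those of the bias-product law
    have hmarg : ∀ T₀ : Finset (Fin n), T₀.card ≤ 2 →
        cyl (law I p μ (cl T₀)) T₀ (fun _ => true) = cyl (W I p μ ∅) T₀ (fun _ => true) := by
      intro T₀ hT₀
      have hdom0 : dom I T₀ = ∅ := dom_eq_empty_of_card_lt hinj (by omega)
      have hcl : (cl T₀).card ≤ 2 * K₁ := by have := hK T₀; nlinarith
      have hlt : b * (cl T₀).card < a * r := by
        have h2 : 2 * b * K₁ < c * t :=
          lt_of_lt_of_le (by rw [hc]; exact Nat.lt_succ_of_le (Nat.le_add_right _ _))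
            (Nat.le_mul_of_pos_right c htpos)
        have h3 : c * t ≤ a * r := hct.trans (Nat.le_mul_of_pos_left r ha)
        nlinarith
      have hdomr : (dom I (cl T₀)).card ≤ r := (card_dom_le hB hlt).1
      have hexp : ExpandingOff I T₀ (dom I (cl T₀) \ dom I T₀) := by
        rw [hdom0, sdiff_empty]
        exact expandingOff_of_card_le_two hk hinj hSO hab37 hB hT₀ hdomr
      have h := law_consistent hL hinj hk (hsub T₀) hexp (fun _ => true)
      rw [h]
      unfold law
      rw [hdom0]
    have hs : single (fun S => law I p μ (cl S)) = p := by
      funext v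
      show cyl (law I p μ (cl {v})) {v} (fun _ => true) = p v
      rw [hmarg {v} (by simp), single_W_empty]
    have hpq : ∀ u v : Fin n, u ≠ v → pair (fun S => law I p μ (cl S)) u v = p u * p v := by
      intro u v huv
      show cyl (law I p μ (cl {u, v})) {u, v} (fun _ => true) = _
      rw [hmarg {u, v} (by rw [card_pair huv]), pair_W_empty I p μ huv]
    rw [hs, PstarSAPeeling.momentMatrix_congr_offDiag p hpq]
    exact posSemidef_momentMatrix_product p hp01

end Summit.PneNP.PneNP.Theorems.PairwiseSA
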